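import Summits.CriticalPhenomena.Ising3D.Control2DDataSet
import Summits.CriticalPhenomena.Ising3D.Control2DL19TwoSided099
import Summits.CriticalPhenomena.Ising3D.Control2DL19OpeUC
import Summits.CriticalPhenomena.Ising3D.Control2DL19OpeLC
import Summits.CriticalPhenomena.Ising3D.Control2DL15PBoxTwoSided
import Mathlib.Tactic.Linarith
import Mathlib.Tactic.NormNum
import HarnessLib

/-!
# The 2D Ising blind control: the certified data set as ONE UNCONDITIONAL kernel theorem
(cell `pub-ising3x`, seat controls-1 gen 29; `SCOPE.md` §4(a) closure on the kernel path — CONTROL-ONLY)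

HONEST FRAMING: lottery ticket; floor = tightest certified 3D Ising CFT bounds; no exact-solution
claim without a proof. CONTROL-ONLY: `d = 2`, global blocks, `Δ_σ = 1/8` exact, the two-dimensional
axiom set `A2D′` (de la Fuente, arXiv:1904.09801 §2) — NOT the three-dimensional floor's axiom set;
nothing here is about `d = 3`.

`Control2DDataSet` (controls-1 gen 13) typed the lane's three certified 2D data at `Δ_σ = 1/8` as ONE
statement `ControlDataSet s G δ w ε_lo ε_hi c_lo c_hi p_lo p_hi` and proved the instances of record
`controlDataSet_rb6/rb7` CONDITIONALLY on the external two-reader certificates (hypotheses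
`TwoSided …`, `OpeLowerA2D …`, `OpeUpperA2D …`, `OpeEpsLowerA2D …`, `OpeEpsUpperA2D …`). Every one of
those hypotheses is now a KERNEL theorem (controls-1 gens 15–28, every inequality of every
certificate re-decided by `decide +kernel`, standard axioms):
* (ε)  `twoSided_2d_kernel099 (w) : TwoSided (1/8) 2 1 w (99/100) (20001/20000)` (`Control2DL19TwoSided099`:
  Λ ≤ 19 box cover of `[0, 99/100]` + the Λ = 19 gap certificate);
* (c)  `opeLower_2d_L19_opeLC` / `opeUpper_2d_L19_opeUC` (`Control2DL19OpeLC` / `Control2DL19OpeUC`, the Λ = 19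
  kind-`ope2` pair; composed exactly as in `Control2DL19CTwoSided.cTwoSided_2d_L19` via `cTwoSided_rb6_L19` — this file
  imports the two replays directly so that it does not wait for that cover module's build);
* (λ²) `pBoxTwoSided_2d_L15_decimal : PBoxTwoSided (1/8) 2 1 (197/200) (20001/20000) (123674/10⁶) (127625/10⁶) ∧ …`
  (`Control2DL15PBoxTwoSided`, Λ = 15 kind-`ope2eps` pair on the box `[197/200, 20001/20000]`).

This file assembles them into **`controlDataSet_kernel099 (w)`**: for EVERY window parameter `w`, every
parity-symmetric unitary solution of the 2D `⟨σσσσ⟩` sum rule at `Δ_σ = 1/8` satisfying `A2D′` with its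
sub-gap scalars at one location `x ≥ w` has `0.99 < x < 1.00005`; if its total `(2,2)` coefficient is
`(1/8)²/(2c)` with `c > 0` then `78125/156258 < c < 125/248` (`0.4999744 < c < 0.5040323`); and its total
scalar OPE coefficient at the `ε` location obeys `0.123674 < p_box < 0.127625` (`0.247348 < λ² < 0.25525`)
— with NO external hypothesis left: the 2D control data set rests on the Lean kernel alone. The 2D Ising
values `Δ_ε = 1`, `c = 1/2`, `p_ε = 1/8` lie inside (`controlDataSet_kernel099_truth_inside`).

The only new mathematics is elementary glue: the `λ²` pair lives on the box `[197/200, 20001/20000]` while the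
`ε` statement places the location in the tighter `[99/100, 20001/20000]`; for a datum whose scalars lie in
`{x} ∪ [G, ∞)`, the in-box index set `boxSet e₁ e₂` is the SAME for every box `[e₁, e₂] ∋ x` with `e₂ < G`
(`CrossingData.boxSet_eq_of_location`), hence so is `p_box` (`CrossingData.boxCoeff_eq_of_location`), which
gives the assembly `controlDataSet_of_boxes` with independent `c` and `λ²` boxes containing `[ε_lo, ε_hi]`.

NOTHING numerical about a functional is asserted here; zero grant compute. Sources: linear-functional
exclusion logic, R. Rattazzi, V. S. Rychkov, E. Tonni, A. Vichi, JHEP 12 (2008) 031, §5; island axiom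
set A. de la Fuente, arXiv:1904.09801, §2; Ward identity A. A. Belavin, A. M. Polyakov,
A. B. Zamolodchikov, Nucl. Phys. B 241 (1984) 333, §3 (a HYPOTHESIS renaming `p_T` as `c`).
-/

namespace Summit.CriticalPhenomena.Ising3D.Control2D

open Set
open Literature.MathematicalPhysics.QuantumFieldTheory.ConformalBootstrap3D

/-! ### Elementary glue: the in-box content does not depend on the box around a single location -/

/-- For a datum whose scalars lie in `{x} ∪ [G, ∞)`, the set of in-box scalar indices is the same for
every `ε` box containing `x` and lying below the gap `G`. Elementary. [folklore] -/
theorem CrossingData.boxSet_eq_of_location {D : CrossingData} {G x e₁ e₂ f₁ f₂ : ℝ}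
    (hS : D.ScalarsIn ({x} ∪ Ici G)) (hx : x ∈ Icc e₁ e₂) (hx' : x ∈ Icc f₁ f₂) (he : e₂ < G)
    (hf : f₂ < G) : D.boxSet e₁ e₂ = D.boxSet f₁ f₂ := by
  ext i
  simp only [CrossingData.boxSet, mem_setOf_eq]
  constructor
  · rintro ⟨hi0, hiΔ⟩
    refine ⟨hi0, ?_⟩
    rcases hS i hi0 with h | h
    · rw [mem_singleton_iff] at h
      rw [h]
      exact hx'
    · exact absurd (lt_of_lt_of_le he (mem_Ici.mp h)) (not_lt.mpr hiΔ.2)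
  · rintro ⟨hi0, hiΔ⟩
    refine ⟨hi0, ?_⟩
    rcases hS i hi0 with h | h
    · rw [mem_singleton_iff] at h
      rw [h]
      exact hx
    · exact absurd (lt_of_lt_of_le hf (mem_Ici.mp h)) (not_lt.mpr hiΔ.2)

/-- Hence the total in-box scalar coefficient `p_box` is the same for every such box (it is the
coefficient mass AT the location `x`). Elementary. [folklore] -/
theorem CrossingData.boxCoeff_eq_of_location {D : CrossingData} {G x e₁ e₂ f₁ f₂ : ℝ}
    (hS : D.ScalarsIn ({x} ∪ Ici G)) (hx : x ∈ Icc e₁ e₂) (hx' : x ∈ Icc f₁ f₂) (he : e₂ < G)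
    (hf : f₂ < G) : D.boxCoeff e₁ e₂ = D.boxCoeff f₁ f₂ := by
  unfold CrossingData.boxCoeff
  rw [CrossingData.boxSet_eq_of_location hS hx hx' he hf]

/-- **Assembly of the data set with independent boxes**: the class-1 `Δ_ε` statement on the window
`x ≥ w` with `ε` interval `(ε_lo, ε_hi)`, a two-sided `c` statement on a box `[e₁, e₂] ⊇ [ε_lo, ε_hi]`, and a
two-sided `p_box` statement on a box `[f₁, f₂] ⊇ [ε_lo, ε_hi]` lying below the gap (`f₂ < G`) give
`ControlDataSet s G δ w ε_lo ε_hi c_lo c_hi p_lo p_hi`. PROVED (the `Δ_ε` statement places `x` in all three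
boxes; `p_box` over `[ε_lo, ε_hi]` equals `p_box` over `[f₁, f₂]` by `boxCoeff_eq_of_location`).
[cite: RattazziEtAl2008, §5] -/
theorem controlDataSet_of_boxes {s G δ w εlo εhi e₁ e₂ f₁ f₂ clo chi plo phi : ℝ}
    (hε : TwoSided s G δ w εlo εhi) (hc : CTwoSided s G δ e₁ e₂ clo chi) (he₁ : e₁ ≤ εlo)
    (he₂ : εhi ≤ e₂) (hp : PBoxTwoSided s G δ f₁ f₂ plo phi) (hf₁ : f₁ ≤ εlo) (hf₂ : εhi ≤ f₂)
    (hfG : f₂ < G) : ControlDataSet s G δ w εlo εhi clo chi plo phi := by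
  intro D hU hC hT2 x hwx hS
  obtain ⟨h1, h2⟩ := hε D hU hC hT2 x hwx hS
  have hxε : x ∈ Icc εlo εhi := ⟨h1.le, h2.le⟩
  have hxf : x ∈ Icc f₁ f₂ := ⟨hf₁.trans h1.le, h2.le.trans hf₂⟩
  have hbox_c : D.ScalarsIn (Icc e₁ e₂ ∪ Ici G) :=
    hS.box_of_location ⟨he₁.trans h1.le, h2.le.trans he₂⟩
  have hbox_p : D.ScalarsIn (Icc f₁ f₂ ∪ Ici G) := hS.box_of_location hxf
  have hpeq : D.boxCoeff εlo εhi = D.boxCoeff f₁ f₂ :=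
    CrossingData.boxCoeff_eq_of_location hS hxε hxf (lt_of_le_of_lt hf₂ hfG) hfG
  refine ⟨⟨h1, h2⟩, fun c hcpos hW => hc D hU hC hbox_c hT2 c hcpos hW, ?_⟩
  rw [hpeq]
  exact hp D hU hC hbox_p hT2

/-! ### The data set of record, kernel-complete -/

/-- **The 2D control data set, KERNEL-COMPLETE (CONTROL-ONLY; `Δ_σ = 1/8`; no external hypothesis).**
For EVERY window parameter `w`: every `A2D′` datum at `Δ_σ = 1/8` (`G = 2`, `δ = 1`) with its sub-gap
scalars at one location `x ≥ w` has `99/100 < x < 20001/20000`; `78125/156258 < c < 125/248` whenever its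
total `(2,2)` coefficient is `(1/8)²/(2c)`, `c > 0` (Ward); and `123674/10⁶ < p_box < 127625/10⁶`
(`0.247348 < λ²_{σσ[ε]} < 0.25525`). Assembled from the kernel theorems `twoSided_2d_kernel099` (Λ ≤ 19
class-1 cover + Λ = 19 gap), `opeLower_2d_L19_opeLC` / `opeUpper_2d_L19_opeUC` (Λ = 19 kind `ope2`, box
`[49/50, 20001/20000]`; the composition `cTwoSided_2d_L19`) and `pBoxTwoSided_2d_L15_decimal` (Λ = 15 kind
`ope2eps`, box `[197/200, 20001/20000]`); every certificate
obligation behind them was re-decided in the Lean kernel (controls-1 gens 15–28). The conditional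
instances `controlDataSet_rb6/rb7` of `Control2DDataSet` are hereby discharged on the `ε`/`c` data and on
the RB-6 `λ²` window. [cite: RattazziEtAl2008, §5] -/
theorem controlDataSet_kernel099 (w : ℝ) :
    ControlDataSet (1 / 8) 2 1 w (99 / 100) (20001 / 20000) (78125 / 156258) (125 / 248)
      (123674 / 1000000) (127625 / 1000000) := by
  have hc := cTwoSided_rb6_L19 opeLower_2d_L19_opeLC opeUpper_2d_L19_opeUC
  obtain ⟨e1, e2, -, -⟩ := cTwoSided_rb6_L19_edges
  rw [e1, e2] at hc
  exact controlDataSet_of_boxes (twoSided_2d_kernel099 w) hc (by norm_num) le_rfl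
    pBoxTwoSided_2d_L15_decimal.1 (by norm_num) le_rfl (by norm_num)

/-- The no-window form (`w = 0`; negative locations are excluded by unitarity anyway), matching the
signature shape of `controlDataSet_rb6/rb7`. [cite: RattazziEtAl2008, §5] -/
theorem controlDataSet_kernel099_noWindow :
    ControlDataSet (1 / 8) 2 1 0 (99 / 100) (20001 / 20000) (78125 / 156258) (125 / 248)
      (123674 / 1000000) (127625 / 1000000) :=
  controlDataSet_kernel099 0

/-- The 2D Ising CFT values `Δ_ε = 1`, `c = 1/2`, `p_ε = λ²_{σσε}/2 = 1/8` lie inside the three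
kernel-certified intervals of `controlDataSet_kernel099` (interval widths `1.005e-2`, `4.06e-3`,
`3.95e-3`). Sanity arithmetic. [folklore] -/
theorem controlDataSet_kernel099_truth_inside :
    ((99 / 100 : ℝ) < 1 ∧ (1 : ℝ) < 20001 / 20000) ∧
      ((78125 / 156258 : ℝ) < 1 / 2 ∧ (1 / 2 : ℝ) < 125 / 248) ∧
        ((123674 / 1000000 : ℝ) < 1 / 8 ∧ (1 / 8 : ℝ) < 127625 / 1000000) := by
  refine ⟨⟨by norm_num, by norm_num⟩, ⟨by norm_num, by norm_num⟩, ⟨by norm_num, by norm_num⟩⟩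

/-- **Unconditional spelling** (the statement with `ControlDataSet` unfolded, so that a reader sees the
quantifiers): for every `A2D′` datum at `Δ_σ = 1/8` and every location `x` of its sub-gap scalars,
the three certified windows hold. [cite: RattazziEtAl2008, §5] -/
theorem controlDataSet_kernel099_explicit (D : CrossingData) (hU : D.IsUnitary)
    (hC : D.SatisfiesCrossing (1 / 8)) (hT2 : D.SpinTwoIn ({2} ∪ Ici (2 + 1))) (x : ℝ)
    (hS : D.ScalarsIn ({x} ∪ Ici 2)) :
    ((99 / 100 : ℝ) < x ∧ x < 20001 / 20000) ∧
      (∀ c : ℝ, 0 < c → D.stressCoeff = (1 / 8 : ℝ) ^ 2 / (2 * c) →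
        (78125 / 156258 : ℝ) < c ∧ c < 125 / 248) ∧
      ((123674 / 1000000 : ℝ) < D.boxCoeff (99 / 100) (20001 / 20000) ∧
        D.boxCoeff (99 / 100) (20001 / 20000) < 127625 / 1000000) :=
  controlDataSet_kernel099 x D hU hC hT2 x le_rfl hS

end Summit.CriticalPhenomena.Ising3D.Control2D
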